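import Literature.AlgebraicGeometry.Modules.LineBundleOfCocycleClass
import Literature.AlgebraicGeometry.Modules.UnitCocyclePresented
import Literature.AlgebraicGeometry.Modules.PullbackFrame
import Literature.AlgebraicGeometry.Modules.IsoOfSectionsOnBasis
import HarnessLib

/-!
# The natural isomorphism `g^*(lineBundle c) ≅ lineBundle (c.pullback g)`

Layer `Literature/AlgebraicGeometry/Modules`; namespace `Literature.AlgebraicGeometry.Modules.UnitCocycle`.
Continuation of `Modules/LineBundleOfCocycle.lean` (the `𝒪_X`-module `lineBundle c` glued from a Čech `1`-cocycle of
units `c = (U_x, g_{xy})`, sections = glue families `(s_x)_x`, `s_x = g_{xy} s_y`) and `Modules/UnitCocyclePullback.lean`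
(the pulled-back cocycle `c.pullback g = (g⁻¹U_{g x}, g^♯ g_{gx,gy})`; its unfolding `pullback_g` and the `appLE`
bookkeeping `secRes_appLE`/`appLE_secRes` are in `Modules/UnitCocyclePresented.lean`).  For a morphism of schemes
`g : X ⟶ Y` and a cocycle `c` on `Y` we construct THE NATURAL isomorphism of `𝒪_X`-modules

  `pullbackLineBundleIso g c : (Scheme.Modules.pullback g).obj (lineBundle c) ≅ lineBundle (c.pullback g)`

(Hartshorne II Ex. 6.8 (a) with III Ex. 4.5: `g^*` of the line bundle with transition functions `g_{xy}` is the line bundle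
with transition functions `g^♯ g_{xy}` — so far the tree only had this at the level of classes, ★ `detClass_pullback`,
★ `nonempty_pullback_lineBundle_toUnitCocycle_iso`).  Mathlib's `Scheme.Modules.pullback g` is abstract (a left adjoint,
[StacksProject, Tag 01CB]), so everything is extracted from the adjunction `g^* ⊣ g_*`:

* §1 `pullComp`, `pullbackFlatFun`, **`pullbackFlat g c : lineBundle c ⟶ g_* lineBundle (c.pullback g)`** — the FLAT map
  `s ↦ (g^♯(s_{g x}))_x` (a glue family for `c.pullback g`, `isGlueFamily_pullComp`; additive, compatible with restriction,
  `g^♯`-semilinear);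
* §2 **`pullbackHom g c : g^*(lineBundle c) ⟶ lineBundle (c.pullback g)`** — its transpose, with THE computation rule
  **`pullbackHom_app_unitSection`**: `pullbackHom (η s) = (g^♯(s_{g x}))_x` on the pulled-back sections
  `η(s) = unitSection g _ W s` (★ `Modules/PullbackUnitSections`), componentwise `comp_pullbackHom_app_unitSection`, and on
  generators **`pullbackHom_app_unitSection_lineBundleGen`**: `η(t_{g x}) ↦ t'_x`;
* §3 **`isIso_pullbackHom`** — bijective on the sections over every open below some `U'_x = g⁻¹U_{g x}` (there the target
  sections are the `r • t'_x`, ★ `eq_smul_lineBundleGen`, and the source sections the `r • η(t_{g x})`, by the pulled-back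
  frame ★ `pullbackFrame g (c.lineBundleFrame (g x))` and ★ `eq_sum_coord_smul`), and isomorphisms of `𝒪_X`-modules are
  local (★ `isIso_of_bijective_on_basis`); whence **`pullbackLineBundleIso`** with `pullbackLineBundleIso_hom_app_unitSection`,
  `pullbackLineBundleIso_inv_app_pullbackFlatFun`.

The compatibilities with `pullbackComp` / `pullbackCongr` (composites, equal morphisms, endomorphisms over `g`) are in the
sequel `Modules/LineBundleOfCocyclePullbackComp.lean`.  Everything is proved; no named facts, no instance, no `sorry`.
Cell `hodgecm-mathlib` (D-0151), (h9-S) (W2-i), generic `Modules/` capital (consumer: the Kummer-pairing fibre identification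
(W2-iii), and every «`g^*𝒪(D) ≅ 𝒪(g^*D)`»); HC_CM is proved only modulo the 7 printed citations until rung 0 closes.

## References

* R. Hartshorne, *Algebraic Geometry*, GTM 52 (1977), II Ex. 6.8 (a) (p. 150, `f^*` on `Pic`), III Ex. 4.5 (p. 224,
  `Pic X ≅ Ȟ¹(X, 𝒪_X^×)`), II.5 (p. 110, `f^*`). [Hartshorne1977]
* The Stacks project, Tag 01CB (functoriality of sheaves of modules; `f^*` left adjoint to `f_*`). [StacksProject]
-/

noncomputable section


open CategoryTheory AlgebraicGeometry Opposite TopologicalSpace Limits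

namespace Literature.AlgebraicGeometry.Modules

open Literature.AlgebraicGeometry.Motives

universe u

variable {X Y : Scheme.{u}} (g : X ⟶ Y) (c : UnitCocycle Y)

namespace UnitCocycle

/-! ### The flat map `lineBundle c ⟶ g_* lineBundle (c.pullback g)` -/

/-- The `x`-component `g^♯(s_{g x}) ∈ Γ(X, g⁻¹W ⊓ U'_x)` of the pull-back of a section `s ∈ Γ(lineBundle c, W)`.
[cite: Hartshorne1977, II Ex. 6.8 (a) and III Ex. 4.5] -/
def pullComp (W : Y.Opens) (s : Γ(lineBundle c, W)) (x : X) : Γ(X, g ⁻¹ᵁ W ⊓ (c.pullback g).U x) :=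
  g.appLE (W ⊓ c.U (g.base x)) (g ⁻¹ᵁ W ⊓ (c.pullback g).U x) (le_preimage_inf g inf_le_left inf_le_right)
    (c.comp s (g.base x))

/-- The components `g^♯(s_{g x})` form a glue family for the pulled-back cocycle:
`g^♯(s_{gx}) = g^♯(g_{gx,gy}) g^♯(s_{gy})`. [cite: Hartshorne1977, II Ex. 6.8 (a) and III Ex. 4.5] -/
lemma isGlueFamily_pullComp (W : Y.Opens) (s : Γ(lineBundle c, W)) :
    (c.pullback g).IsGlueFamily (g ⁻¹ᵁ W) (fun x => pullComp g c W s x) := by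
  intro x y V' hV hx hy
  -- move everything to `W ⊓ U_{gx} ⊓ U_{gy}`
  let W₃ : Y.Opens := W ⊓ c.U (g.base x) ⊓ c.U (g.base y)
  have e₃ : V' ≤ g ⁻¹ᵁ W₃ := le_preimage_inf g (le_preimage_inf g hV hx) hy
  have hrel := c.comp_rel s (g.base x) (g.base y) W₃ (inf_le_left.trans inf_le_left)
    (inf_le_left.trans inf_le_right) inf_le_right
  unfold pullComp
  rw [pullback_g, secRes_appLE, secRes_appLE,
    ← appLE_secRes g (le_inf (inf_le_left.trans inf_le_left) (inf_le_left.trans inf_le_right) : W₃ ≤ W ⊓ c.U (g.base x)) e₃,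
    ← appLE_secRes g (le_inf (inf_le_left.trans inf_le_left) inf_le_right : W₃ ≤ W ⊓ c.U (g.base y)) e₃,
    ← appLE_secRes g (le_inf (inf_le_left.trans inf_le_right) inf_le_right : W₃ ≤ c.U (g.base x) ⊓ c.U (g.base y)) e₃,
    hrel, map_mul, c.map_g]

/-- The underlying function of the flat map on sections over `W`: `s ↦ (g^♯(s_{g x}))_x`, a section of
`lineBundle (c.pullback g)` over `g⁻¹W`. [cite: Hartshorne1977, II Ex. 6.8 (a) and III Ex. 4.5] -/
def pullbackFlatFun (W : Y.Opens) (s : Γ(lineBundle c, W)) : Γ(lineBundle (c.pullback g), g ⁻¹ᵁ W) :=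
  (c.pullback g).mkSection (g ⁻¹ᵁ W) (fun x => pullComp g c W s x) (isGlueFamily_pullComp g c W s)

/-- Components of `pullbackFlatFun`. [cite: Hartshorne1977, II Ex. 6.8 (a) and III Ex. 4.5] -/
@[simp]
lemma comp_pullbackFlatFun (W : Y.Opens) (s : Γ(lineBundle c, W)) (x : X) :
    (c.pullback g).comp (pullbackFlatFun g c W s) x = pullComp g c W s x := rfl

/-- Restricting a component `g^♯(s_{g x})` to a smaller open. [cite: Hartshorne1977, II Ex. 6.8 (a) and III Ex. 4.5] -/
lemma secRes_pullComp (W : Y.Opens) (s : Γ(lineBundle c, W)) (x : X) {V' : X.Opens}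
    (i : V' ≤ g ⁻¹ᵁ W ⊓ (c.pullback g).U x) :
    secRes X i (pullComp g c W s x) =
      g.appLE (W ⊓ c.U (g.base x)) V' (i.trans (le_preimage_inf g inf_le_left inf_le_right)) (c.comp s (g.base x)) := by
  unfold pullComp
  rw [secRes_appLE]

/-- `pullbackFlatFun` is additive. [cite: Hartshorne1977, II Ex. 6.8 (a) and III Ex. 4.5] -/
lemma pullbackFlatFun_add (W : Y.Opens) (s t : Γ(lineBundle c, W)) :
    pullbackFlatFun g c W (s + t) = pullbackFlatFun g c W s + pullbackFlatFun g c W t := by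
  ext x
  simp only [comp_pullbackFlatFun, comp_add, pullComp, map_add]

/-- `pullbackFlatFun` is compatible with restriction. [cite: Hartshorne1977, II Ex. 6.8 (a) and III Ex. 4.5] -/
lemma pullbackFlatFun_map {W W' : Y.Opens} (i : W' ⟶ W) (s : Γ(lineBundle c, W)) :
    pullbackFlatFun g c W' ((lineBundle c).presheaf.map i.op s) =
      (lineBundle (c.pullback g)).presheaf.map ((Opens.map g.base).map i).op (pullbackFlatFun g c W s) := by
  ext x
  rw [comp_pullbackFlatFun, comp_map, comp_pullbackFlatFun]
  unfold pullComp
  rw [comp_map, appLE_secRes, secRes_appLE]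

/-- `pullbackFlatFun` is `g^♯`-semilinear. [cite: Hartshorne1977, II Ex. 6.8 (a) and III Ex. 4.5] -/
lemma pullbackFlatFun_smul (W : Y.Opens) (r : Γ(Y, W)) (s : Γ(lineBundle c, W)) :
    pullbackFlatFun g c W (r • s) = g.app W r • pullbackFlatFun g c W s := by
  ext x
  rw [comp_pullbackFlatFun, comp_smul, comp_pullbackFlatFun]
  unfold pullComp
  rw [comp_smul, map_mul, appLE_secRes]
  -- `g^♯(r)|_{g⁻¹W ⊓ U'_x} = (g^♯ r)|` holds by `rfl` (`appLE = app ≫ map`)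
  congr 1

/-- **The flat map `lineBundle c ⟶ g_* lineBundle (c.pullback g)`**, `s ↦ (g^♯(s_{g x}))_x` on sections over `W ⊆ Y`
(a morphism of `𝒪_Y`-modules: additive, compatible with restriction, `g^♯`-semilinear).
[cite: Hartshorne1977, II Ex. 6.8 (a) and III Ex. 4.5] -/
def pullbackFlat : lineBundle c ⟶ (Scheme.Modules.pushforward g).obj (lineBundle (c.pullback g)) where
  val := PresheafOfModules.homMk
    { app := fun W => AddCommGrpCat.ofHom
        { toFun := fun s => (pullbackFlatFun g c W.unop s : Γ(lineBundle (c.pullback g), g ⁻¹ᵁ W.unop))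
          map_zero' := by
            have h := pullbackFlatFun_add g c W.unop 0 0
            rw [add_zero] at h
            exact left_eq_add.mp h
          map_add' := pullbackFlatFun_add g c W.unop }
      naturality := fun {W W'} i => by
        ext s
        exact pullbackFlatFun_map g c i.unop s }
    (fun W r s => by
      change pullbackFlatFun g c W.unop (r • s) = g.app W.unop r • pullbackFlatFun g c W.unop s
      exact pullbackFlatFun_smul g c W.unop r s)

/-- Sections of `pullbackFlat`. [cite: Hartshorne1977, II Ex. 6.8 (a) and III Ex. 4.5] -/
@[simp]
lemma pullbackFlat_app (W : Y.Opens) (s : Γ(lineBundle c, W)) :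
    (pullbackFlat g c).app W s = pullbackFlatFun g c W s := rfl

/-! ### The adjoint map `g^* lineBundle c ⟶ lineBundle (c.pullback g)` -/

/-- **The natural map `g^*(lineBundle c) ⟶ lineBundle (c.pullback g)`**: the transpose of `pullbackFlat` under
Mathlib's adjunction `g^* ⊣ g_*` (`Scheme.Modules.pullbackPushforwardAdjunction`).
[cite: Hartshorne1977, II Ex. 6.8 (a) and III Ex. 4.5] -/
def pullbackHom : (Scheme.Modules.pullback g).obj (lineBundle c) ⟶ lineBundle (c.pullback g) :=
  ((Scheme.Modules.pullbackPushforwardAdjunction g).homEquiv _ _).symm (pullbackFlat g c)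

/-- `pullbackFlat` is the unit followed by `g_*` of `pullbackHom` (transposition).
[cite: Hartshorne1977, II Ex. 6.8 (a) and III Ex. 4.5] -/
theorem unit_comp_map_pullbackHom :
    (Scheme.Modules.pullbackPushforwardAdjunction g).unit.app (lineBundle c) ≫
      (Scheme.Modules.pushforward g).map (pullbackHom g c) = pullbackFlat g c := by
  have h := (Scheme.Modules.pullbackPushforwardAdjunction g).homEquiv_unit (X := lineBundle c)
    (Y := lineBundle (c.pullback g)) (f := pullbackHom g c)
  refine h.symm.trans ?_
  rw [pullbackHom, Equiv.apply_symm_apply]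

/-- **The computation rule**: on a pulled-back section `η(s)`, `s ∈ Γ(lineBundle c, W)`, the natural map takes the value
`(g^♯(s_{g x}))_x ∈ Γ(lineBundle (c.pullback g), g⁻¹W)`. [cite: Hartshorne1977, II Ex. 6.8 (a) and III Ex. 4.5] -/
theorem pullbackHom_app_unitSection (W : Y.Opens) (s : Γ(lineBundle c, W)) :
    (pullbackHom g c).app (g ⁻¹ᵁ W) (unitSection g (lineBundle c) W s) = pullbackFlatFun g c W s := by
  change (((Scheme.Modules.pullbackPushforwardAdjunction g).unit.app (lineBundle c) ≫
    (Scheme.Modules.pushforward g).map (pullbackHom g c)).app W) s = _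
  rw [unit_comp_map_pullbackHom]
  rfl

/-- Components of the computation rule: `(pullbackHom (η s))_x = g^♯(s_{g x})`.
[cite: Hartshorne1977, II Ex. 6.8 (a) and III Ex. 4.5] -/
theorem comp_pullbackHom_app_unitSection (W : Y.Opens) (s : Γ(lineBundle c, W)) (x : X) :
    (c.pullback g).comp ((pullbackHom g c).app (g ⁻¹ᵁ W) (unitSection g (lineBundle c) W s)) x =
      pullComp g c W s x := by
  rw [pullbackHom_app_unitSection, comp_pullbackFlatFun]

/-- **The natural map sends the pulled-back generator `η(t_{g x})` to the generator `t'_x`** of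
`lineBundle (c.pullback g)` over `U'_x = g⁻¹U_{g x}`. [cite: Hartshorne1977, II Ex. 6.8 (a) and III Ex. 4.5] -/
theorem pullbackHom_app_unitSection_lineBundleGen (x : X) :
    (pullbackHom g c).app (g ⁻¹ᵁ c.U (g.base x))
        (unitSection g (lineBundle c) (c.U (g.base x)) (c.lineBundleGen (g.base x) (c.U (g.base x)) le_rfl)) =
      (c.pullback g).lineBundleGen x (g ⁻¹ᵁ c.U (g.base x)) le_rfl := by
  rw [pullbackHom_app_unitSection]
  ext y
  rw [comp_pullbackFlatFun, comp_lineBundleGen, pullback_g]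
  unfold pullComp
  rw [comp_lineBundleGen, ← c.map_g (g.base y) (g.base x) (V := c.U (g.base y) ⊓ c.U (g.base x)) inf_le_left
    inf_le_right (le_inf inf_le_right inf_le_left), appLE_secRes]

/-! ### The natural map is an isomorphism -/

/-- Over `V ≤ U'_x`, the natural map is surjective: every section of `lineBundle (c.pullback g)` over `V` is `r • t'_x`
(★ `eq_smul_lineBundleGen`) and `t'_x` is the image of `η(t_{g x})`. [cite: Hartshorne1977, II Ex. 6.8 (a) and III Ex. 4.5] -/
lemma pullbackHom_app_surjective (x : X) {V : X.Opens} (hV : V ≤ g ⁻¹ᵁ c.U (g.base x)) :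
    Function.Surjective ((pullbackHom g c).app V) := by
  intro t
  refine ⟨secRes X (le_inf le_rfl hV) ((c.pullback g).comp t x) •
    ((Scheme.Modules.pullback g).obj (lineBundle c)).presheaf.map (homOfLE hV).op
      (unitSection g (lineBundle c) (c.U (g.base x)) (c.lineBundleGen (g.base x) (c.U (g.base x)) le_rfl)), ?_⟩
  rw [Scheme.Modules.Hom.app_smul, Scheme.Modules.Hom.app_map_apply, pullbackHom_app_unitSection_lineBundleGen,
    map_lineBundleGen]
  exact ((c.pullback g).eq_smul_lineBundleGen x V hV t).symm

/-- Over `V ≤ U'_x`, every section of `g^*(lineBundle c)` is `r • η(t_{g x})|_V` (the pulled-back frame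
★ `pullbackFrame` of ★ `lineBundleFrame`). [cite: Hartshorne1977, II Ex. 6.8 (a) and III Ex. 4.5] -/
lemma eq_smul_unitSection_lineBundleGen (x : X) {V : X.Opens} (hV : V ≤ g ⁻¹ᵁ c.U (g.base x))
    (u : Γ((Scheme.Modules.pullback g).obj (lineBundle c), V)) :
    u = coord (pullbackFrame g (c.lineBundleFrame (g.base x))) (homOfLE hV) u PUnit.unit •
      ((Scheme.Modules.pullback g).obj (lineBundle c)).presheaf.map (homOfLE hV).op
        (unitSection g (lineBundle c) (c.U (g.base x)) (c.lineBundleGen (g.base x) (c.U (g.base x)) le_rfl)) := by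
  have hu := eq_sum_coord_smul (pullbackFrame g (c.lineBundleFrame (g.base x))) (homOfLE hV) u
  rw [Fintype.sum_unique, basisSection_pullbackFrame, basisSection_lineBundleFrame] at hu
  exact hu

/-- Over `V ≤ U'_x`, the natural map is injective. [cite: Hartshorne1977, II Ex. 6.8 (a) and III Ex. 4.5] -/
lemma pullbackHom_app_injective (x : X) {V : X.Opens} (hV : V ≤ g ⁻¹ᵁ c.U (g.base x)) :
    Function.Injective ((pullbackHom g c).app V) := by
  have key : ∀ u, (pullbackHom g c).app V u = 0 → u = 0 := by
    intro u hu
    rw [eq_smul_unitSection_lineBundleGen g c x hV u] at hu ⊢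
    rw [Scheme.Modules.Hom.app_smul, Scheme.Modules.Hom.app_map_apply, pullbackHom_app_unitSection_lineBundleGen,
      map_lineBundleGen] at hu
    have h0 := congrArg (fun s => (c.pullback g).comp s x) hu
    simp only [comp_smul, comp_lineBundleGen, (c.pullback g).g_self, mul_one] at h0
    have hr : coord (pullbackFrame g (c.lineBundleFrame (g.base x))) (homOfLE hV) u PUnit.unit = 0 :=
      injective_presheaf_map_of_hom (homOfLE (inf_le_left : V ⊓ (g ⁻¹ᵁ c.U (g.base x)) ≤ V))
        (homOfLE (le_inf le_rfl hV)) (h0.trans (map_zero _).symm)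
    rw [hr, zero_smul]
  intro u₁ u₂ h
  rw [← sub_eq_zero]
  refine key _ ?_
  rw [map_sub, h, sub_self]

/-- **`pullbackHom g c : g^*(lineBundle c) ⟶ lineBundle (c.pullback g)` is an isomorphism** (bijective on the
sections over every open below some `U'_x`; isomorphisms of `𝒪_X`-modules are local, ★ `isIso_of_bijective_on_basis`).
[cite: Hartshorne1977, II Ex. 6.8 (a) and III Ex. 4.5] -/
theorem isIso_pullbackHom : IsIso (pullbackHom g c) := by
  refine isIso_of_bijective_on_basis (pullbackHom g c) (B := {V : X.Opens | ∃ x : X, V ≤ g ⁻¹ᵁ c.U (g.base x)})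
    ?_ ?_
  · refine Opens.isBasis_iff_nbhd.mpr fun {O x} hx => ?_
    exact ⟨O ⊓ g ⁻¹ᵁ c.U (g.base x), ⟨x, inf_le_right⟩, ⟨hx, c.mem (g.base x)⟩, inf_le_left⟩
  · rintro V ⟨x, hV⟩
    exact ⟨pullbackHom_app_injective g c x hV, pullbackHom_app_surjective g c x hV⟩

/-- **The natural isomorphism `g^*(lineBundle c) ≅ lineBundle (c.pullback g)`** (Hartshorne II Ex. 6.8 (a): pull-back of
line bundles in terms of transition functions — `g^*` of the bundle glued from `(U_x, g_{xy})` is the bundle glued from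
`(g⁻¹U_{gx}, g^♯ g_{gx,gy})`). [cite: Hartshorne1977, II Ex. 6.8] -/
def pullbackLineBundleIso : (Scheme.Modules.pullback g).obj (lineBundle c) ≅ lineBundle (c.pullback g) :=
  haveI := isIso_pullbackHom g c
  asIso (pullbackHom g c)

/-- The isomorphism is the natural map. [cite: Hartshorne1977, II Ex. 6.8 (a) and III Ex. 4.5] -/
theorem pullbackLineBundleIso_hom : (pullbackLineBundleIso g c).hom = pullbackHom g c := rfl

/-- The computation rule for the isomorphism: `η(s) ↦ (g^♯(s_{g x}))_x`. [cite: Hartshorne1977, II Ex. 6.8] -/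
theorem pullbackLineBundleIso_hom_app_unitSection (W : Y.Opens) (s : Γ(lineBundle c, W)) :
    (pullbackLineBundleIso g c).hom.app (g ⁻¹ᵁ W) (unitSection g (lineBundle c) W s) = pullbackFlatFun g c W s :=
  pullbackHom_app_unitSection g c W s

/-- The inverse isomorphism on `(g^♯(s_{g x}))_x` is `η(s)`. [cite: Hartshorne1977, II Ex. 6.8] -/
theorem pullbackLineBundleIso_inv_app_pullbackFlatFun (W : Y.Opens) (s : Γ(lineBundle c, W)) :
    (pullbackLineBundleIso g c).inv.app (g ⁻¹ᵁ W) (pullbackFlatFun g c W s) = unitSection g (lineBundle c) W s := by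
  rw [← pullbackLineBundleIso_hom_app_unitSection, ← CategoryTheory.comp_apply, ← Scheme.Modules.Hom.comp_app,
    Iso.hom_inv_id, Scheme.Modules.Hom.id_app, CategoryTheory.id_apply]

end UnitCocycle

end Literature.AlgebraicGeometry.Modules

end
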